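/-
Copyright (c) 2026. All rights reserved.
Released under Apache 2.0 license as described in the file LICENSE.
Authors: abc-iut cell — seat abc-iut-L6-t15 (gen 3): proof-only companion to `HolomorphicCores`
([AbsTopIII] Prop 2.5), no new definitions.
-/
import Literature.AnabelianGeometry.AbsoluteAnabelian.ParallelogramsPlanarSquareChains

/-!
# Planar geometry behind [AbsTopIII] Prop 2.5, VIII: the algorithm recovers exactly `𝒫(U)`

Proof-only companion (no definitions) to `HolomorphicCores.lean`, continuing
`ParallelogramsPlanarSquareChains`.  For an open `U ⊆ ℂ` and `𝒮(U) ⊆ 𝒬 ⊆ 𝒫(U)`: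

* Prop 2.5 (c), converse direction: every genuine pre-compact parallelogram `P ∈ 𝒫(U)` is recovered — its
  four edges form a pre-∂-parallelogram of `(U, 𝒬)` whose pre-parallelogram is `P̄`, with interior `P`;
* hence `Parallelograms.parallelograms 𝒬 = {P | val '' P ∈ 𝒫(U)}`; in particular (first half of the named
  fact `TwoOrientations`) `Parallelograms.parallelograms 𝒮(U) = 𝒫(U)`.

Refereed classical mathematics (S. Mochizuki, *Topics in absolute anabelian geometry III*, §2; kurims
pages); nothing here bears on the disputed parts of IUT.
-/

namespace Literature.AnabelianGeometry.AbsoluteAnabelian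

open _root_.Complex _root_.Set _root_.Topology _root_.Filter _root_.Metric

noncomputable section

/-- `Parallel` is symmetric. (Auxiliary.) [cite: MochizukiAbsTopIII2015, Proposition 2.5 (b) p.56] -/
theorem Parallelograms.Parallel.symm {U : Type*} {𝒬 : Set (Set U)} {L L' : Set U}
    (h : Parallelograms.Parallel 𝒬 L L') : Parallelograms.Parallel 𝒬 L' L :=
  ⟨h.2.1, h.1, Relation.EqvGen.symm _ _ h.2.2⟩

/-- A horizontal and a vertical edge of the unit square meet exactly in the corner.
(Auxiliary.) [cite: MochizukiAbsTopIII2015, Proposition 2.5 (proof) pp.55–57] -/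
theorem sq_edges_inter_eq_corner {s t : ℝ} (hs : s = 0 ∨ s = 1) (ht : t = 0 ∨ t = 1) :
    (Icc (0 : ℝ) 1 ×ℂ {t}) ∩ ({s} ×ℂ Icc (0 : ℝ) 1) = {(⟨s, t⟩ : ℂ)} := by
  refine Subset.antisymm ?_ (singleton_subset_iff.2 (sq_corner_mem_hv hs ht))
  rintro p ⟨⟨-, hp1⟩, hp2, -⟩
  rw [mem_preimage, mem_singleton_iff] at hp1 hp2
  rw [mem_singleton_iff]
  exact Complex.ext hp2 hp1

/-- Adjacent edges meeting in a common end: the intersection pattern required by Prop 2.5 (c).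
(Auxiliary.) [cite: MochizukiAbsTopIII2015, Proposition 2.5 (c) p.56] -/
theorem Parallelograms.inter_eq_endpoints_inter {U : Set ℂ} (hU : IsOpen U) {𝒬 : Set (Set U)}
    (h𝒬 : ∀ Q ∈ 𝒬, Subtype.val '' Q ∈ parallelogramsIn U)
    (h𝒮 : ∀ Q : Set U, Subtype.val '' Q ∈ squaresIn U → Q ∈ 𝒬) {L L' : Set U} {a b a' b' c : ℂ}
    (hab : a ≠ b) (hL : Subtype.val '' L = segment ℝ a b) (ha'b' : a' ≠ b')
    (hL' : Subtype.val '' L' = segment ℝ a' b') (hc : c = a ∨ c = b) (hc' : c = a' ∨ c = b')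
    (hLL' : L ∩ L' = Subtype.val ⁻¹' {c}) :
    L ∩ L' = Parallelograms.endpoints 𝒬 L ∩ Parallelograms.endpoints 𝒬 L' ∧ ∃ x, L ∩ L' = {x} := by
  rw [Parallelograms.endpoints_eq_of_subset hU h𝒬 h𝒮 hab hL,
    Parallelograms.endpoints_eq_of_subset hU h𝒬 h𝒮 ha'b' hL']
  constructor
  · refine Subset.antisymm (fun e he => ?_)
      (fun e he => ⟨he.1.1, he.2.1⟩)
    have hec : (e : ℂ) = c := by have := hLL'.le he; exact this
    refine ⟨⟨he.1, ?_⟩, he.2, ?_⟩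
    · rcases hc with rfl | rfl
      · exact Or.inl hec
      · exact Or.inr hec
    · rcases hc' with rfl | rfl
      · exact Or.inl hec
      · exact Or.inr hec
  · have hcmem : c ∈ Subtype.val '' L := by
      rw [hL]; rcases hc with rfl | rfl
      · exact left_mem_segment ℝ _ _
      · exact right_mem_segment ℝ _ _
    obtain ⟨x, hxL, hxc⟩ := hcmem
    refine ⟨x, ?_⟩
    rw [hLL']
    ext e
    simp only [mem_preimage, mem_singleton_iff]
    constructor
    · intro h; exact Subtype.ext (h.trans hxc.symm)
    · rintro rfl; exact hxc

/-- **Prop 2.5 (c)**, converse: for an open `U ⊆ ℂ` and `𝒮(U) ⊆ 𝒬 ⊆ 𝒫(U)`, every genuine pre-compact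
non-degenerate parallelogram (`val '' P ∈ 𝒫(U)`) is RECOVERED by the algorithm: its four closed edges form a
pre-∂-parallelogram of `(U, 𝒬)` and `P` is the interior of the associated pre-parallelogram.
[cite: MochizukiAbsTopIII2015, Proposition 2.5 (c) p.56] -/
theorem Parallelograms.mem_parallelograms_of_image_val_mem {U : Set ℂ} (hU : IsOpen U)
    {𝒬 : Set (Set U)} (h𝒬 : ∀ Q ∈ 𝒬, Subtype.val '' Q ∈ parallelogramsIn U)
    (h𝒮 : ∀ Q : Set U, Subtype.val '' Q ∈ squaresIn U → Q ∈ 𝒬) {P : Set U}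
    (hP : Subtype.val '' P ∈ parallelogramsIn U) : P ∈ Parallelograms.parallelograms 𝒬 := by
  obtain ⟨z, v, w, hvw, hPe, hKU⟩ := hP
  rw [hPe] at hKU
  obtain ⟨A, hA⟩ := exists_homeomorph_frame z v w hvw
  have hv : v ≠ 0 := by simpa using hvw.ne_zero 0
  have hw : w ≠ 0 := by simpa using hvw.ne_zero 1
  have hK := closure_openParallelogram hvw hA
  -- edges in the frame
  have hE0 : A '' (Icc 0 1 ×ℂ {(0 : ℝ)}) = segment ℝ z (z + v) := by rw [image_frame_Icc_const hA]; simp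
  have hE2 : A '' (Icc 0 1 ×ℂ {(1 : ℝ)}) = segment ℝ (z + w) (z + w + v) := by
    rw [image_frame_Icc_const hA]; simp
  have hE3 : A '' ({(0 : ℝ)} ×ℂ Icc 0 1) = segment ℝ z (z + w) := by rw [image_frame_const_Icc hA]; simp
  have hE1 : A '' ({(1 : ℝ)} ×ℂ Icc 0 1) = segment ℝ (z + v) (z + v + w) := by
    rw [image_frame_const_Icc hA]; simp
  have hedgeK : ∀ {F : Set ℂ}, (F = Icc 0 1 ×ℂ {(0 : ℝ)} ∨ F = Icc 0 1 ×ℂ {(1 : ℝ)} ∨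
      F = {(0 : ℝ)} ×ℂ Icc 0 1 ∨ F = {(1 : ℝ)} ×ℂ Icc 0 1) →
      A '' F ⊆ closure (openParallelogram z v w) := fun hF => by
    rw [hK]; exact image_mono ((sq_edge_subset_boundary hF).trans sdiff_subset)
  have himg : ∀ {T : Set ℂ}, T ⊆ U → Subtype.val '' (Subtype.val ⁻¹' T : Set U) = T := fun hT => by
    rw [image_preimage_eq_inter_range, Subtype.range_coe, inter_eq_left.2 hT]
  -- the four edges as subsets of `U`, in the cyclic order bottom, right, top, left
  set L : ZMod 4 → Set U := ![Subtype.val ⁻¹' (A '' (Icc 0 1 ×ℂ {(0 : ℝ)})),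
    Subtype.val ⁻¹' (A '' ({(1 : ℝ)} ×ℂ Icc 0 1)), Subtype.val ⁻¹' (A '' (Icc 0 1 ×ℂ {(1 : ℝ)})),
    Subtype.val ⁻¹' (A '' ({(0 : ℝ)} ×ℂ Icc 0 1))] with hLdef
  have hL0 : L 0 = Subtype.val ⁻¹' segment ℝ z (z + v) := by rw [← hE0]; rfl
  have hL1 : L 1 = Subtype.val ⁻¹' segment ℝ (z + v) (z + v + w) := by rw [← hE1]; rfl
  have hL2 : L 2 = Subtype.val ⁻¹' segment ℝ (z + w) (z + w + v) := by rw [← hE2]; rfl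
  have hL3 : L 3 = Subtype.val ⁻¹' segment ℝ z (z + w) := by rw [← hE3]; rfl
  have hsegU : ∀ {c d : ℂ}, c ∈ closure (openParallelogram z v w) → d ∈ closure (openParallelogram z v w) →
      segment ℝ c d ⊆ U := fun hc hd =>
    ((convex_closure_openParallelogram z v w).segment_subset hc hd).trans hKU
  have hzK : ∀ s t : ℝ, 0 ≤ s → s ≤ 1 → 0 ≤ t → t ≤ 1 →
      z + (s : ℂ) * v + (t : ℂ) * w ∈ closure (openParallelogram z v w) := fun s t hs hs1 ht ht1 =>
    (mem_closure_openParallelogram_iff hvw).2 ⟨s, t, hs, hs1, ht, ht1, rfl⟩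
  have hK0 : z ∈ closure (openParallelogram z v w) := by simpa using hzK 0 0 le_rfl zero_le_one le_rfl zero_le_one
  have hKv : z + v ∈ closure (openParallelogram z v w) := by
    simpa using hzK 1 0 zero_le_one le_rfl le_rfl zero_le_one
  have hKw : z + w ∈ closure (openParallelogram z v w) := by
    simpa using hzK 0 1 le_rfl zero_le_one zero_le_one le_rfl
  have hKvw : z + v + w ∈ closure (openParallelogram z v w) := by
    simpa using hzK 1 1 zero_le_one le_rfl zero_le_one le_rfl
  have hiL0 : Subtype.val '' L 0 = segment ℝ z (z + v) := by rw [hL0]; exact himg (hsegU hK0 hKv)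
  have hiL1 : Subtype.val '' L 1 = segment ℝ (z + v) (z + v + w) := by rw [hL1]; exact himg (hsegU hKv hKvw)
  have hiL2 : Subtype.val '' L 2 = segment ℝ (z + w) (z + w + v) := by
    rw [hL2]; exact himg (hsegU hKw (by rwa [add_right_comm]))
  have hiL3 : Subtype.val '' L 3 = segment ℝ z (z + w) := by rw [hL3]; exact himg (hsegU hK0 hKw)
  have hne01 : z ≠ z + v := by simpa using hv
  have hne12 : z + v ≠ z + v + w := by simpa using hw
  have hne23 : z + w ≠ z + w + v := by simpa using hv
  have hne30 : z ≠ z + w := by simpa using hw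
  -- all edges lie in the closed parallelogram
  have hLK : ∀ i, Subtype.val '' L i ⊆ closure (openParallelogram z v w) := by
    intro i
    rcases (by decide : ∀ i : ZMod 4, i = 0 ∨ i = 1 ∨ i = 2 ∨ i = 3) i with rfl | rfl | rfl | rfl
    · rw [hiL0]; exact (convex_closure_openParallelogram z v w).segment_subset hK0 hKv
    · rw [hiL1]; exact (convex_closure_openParallelogram z v w).segment_subset hKv hKvw
    · rw [hiL2]; exact (convex_closure_openParallelogram z v w).segment_subset hKw (by rwa [add_right_comm])
    · rw [hiL3]; exact (convex_closure_openParallelogram z v w).segment_subset hK0 hKw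
  -- adjacent edges meet in the corners
  have hI : ∀ {F F' : Set ℂ} {c : ℂ}, F ∩ F' = {c} →
      (Subtype.val ⁻¹' (A '' F) : Set U) ∩ Subtype.val ⁻¹' (A '' F') = Subtype.val ⁻¹' {A c} := by
    intro F F' c h
    rw [← preimage_inter, ← image_inter A.injective, h, image_singleton]
  have c01 : (Icc (0 : ℝ) 1 ×ℂ {(0 : ℝ)}) ∩ ({(1 : ℝ)} ×ℂ Icc (0 : ℝ) 1) = {(⟨1, 0⟩ : ℂ)} :=
    sq_edges_inter_eq_corner (by norm_num) (by norm_num)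
  have c12 : ({(1 : ℝ)} ×ℂ Icc (0 : ℝ) 1) ∩ (Icc (0 : ℝ) 1 ×ℂ {(1 : ℝ)}) = {(⟨1, 1⟩ : ℂ)} := by
    rw [inter_comm]; exact sq_edges_inter_eq_corner (by norm_num) (by norm_num)
  have c23 : (Icc (0 : ℝ) 1 ×ℂ {(1 : ℝ)}) ∩ ({(0 : ℝ)} ×ℂ Icc (0 : ℝ) 1) = {(⟨0, 1⟩ : ℂ)} :=
    sq_edges_inter_eq_corner (by norm_num) (by norm_num)
  have c30 : ({(0 : ℝ)} ×ℂ Icc (0 : ℝ) 1) ∩ (Icc (0 : ℝ) 1 ×ℂ {(0 : ℝ)}) = {(⟨0, 0⟩ : ℂ)} := by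
    rw [inter_comm]; exact sq_edges_inter_eq_corner (by norm_num) (by norm_num)
  have hA10 : A ⟨1, 0⟩ = z + v := by rw [hA]; simp
  have hA11 : A ⟨1, 1⟩ = z + v + w := by rw [hA]; simp
  have hA01 : A ⟨0, 1⟩ = z + w := by rw [hA]; simp
  have hA00 : A ⟨0, 0⟩ = z := by rw [hA]; simp
  have hdisj : ∀ {F F' : Set ℂ}, F ∩ F' = ∅ →
      (Subtype.val ⁻¹' (A '' F) : Set U) ∩ Subtype.val ⁻¹' (A '' F') = ∅ := by
    intro F F' h
    rw [← preimage_inter, ← image_inter A.injective, h, image_empty, preimage_empty]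
  have d02 : (Icc (0 : ℝ) 1 ×ℂ {(0 : ℝ)}) ∩ (Icc (0 : ℝ) 1 ×ℂ {(1 : ℝ)}) = ∅ := by
    ext p; simp [mem_reProdIm]; intro _ _ h; norm_num [h]
  have d13 : ({(1 : ℝ)} ×ℂ Icc (0 : ℝ) 1) ∩ ({(0 : ℝ)} ×ℂ Icc (0 : ℝ) 1) = ∅ := by
    ext p; simp [mem_reProdIm]; intro h; norm_num [h]
  refine ⟨L, ⟨?_, ?_, ?_, ?_⟩, ?_⟩
  · -- (c1) the edges are line segments
    intro i
    rcases (by decide : ∀ i : ZMod 4, i = 0 ∨ i = 1 ∨ i = 2 ∨ i = 3) i with rfl | rfl | rfl | rfl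
    · exact Parallelograms.isLineSegment_edge hU h𝒬 h𝒮 hvw hKU hA (Or.inl rfl)
    · exact Parallelograms.isLineSegment_edge hU h𝒬 h𝒮 hvw hKU hA (Or.inr (Or.inr (Or.inr rfl)))
    · exact Parallelograms.isLineSegment_edge hU h𝒬 h𝒮 hvw hKU hA (Or.inr (Or.inl rfl))
    · exact Parallelograms.isLineSegment_edge hU h𝒬 h𝒮 hvw hKU hA (Or.inr (Or.inr (Or.inl rfl)))
  · -- (c2) chords between boundary points are line segments
    intro p₁ p₂ hp₁ hp₂ hne
    have hK₁ : (p₁ : ℂ) ∈ closure (openParallelogram z v w) := by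
      obtain ⟨i, hi⟩ := mem_iUnion.1 hp₁; exact hLK i (mem_image_of_mem _ hi)
    have hK₂ : (p₂ : ℂ) ∈ closure (openParallelogram z v w) := by
      obtain ⟨i, hi⟩ := mem_iUnion.1 hp₂; exact hLK i (mem_image_of_mem _ hi)
    have hne' : (p₁ : ℂ) ≠ p₂ := fun h => hne (Subtype.ext h)
    have hsub := hsegU hK₁ hK₂
    refine ⟨Subtype.val ⁻¹' segment ℝ (p₁ : ℂ) p₂,
      Parallelograms.isLineSegment_of_segment_subset hU h𝒬 h𝒮 hne' hsub, ?_⟩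
    rw [Parallelograms.endpoints_eq_of_subset hU h𝒬 h𝒮 hne' (himg hsub)]
    ext e
    simp only [mem_inter_iff, mem_preimage, mem_insert_iff, mem_singleton_iff]
    constructor
    · rintro ⟨-, h | h⟩
      · exact Or.inl (Subtype.ext h)
      · exact Or.inr (Subtype.ext h)
    · rintro (rfl | rfl)
      · exact ⟨left_mem_segment ℝ _ _, Or.inl rfl⟩
      · exact ⟨right_mem_segment ℝ _ _, Or.inr rfl⟩
  · -- (c3) opposite edges are parallel and disjoint
    intro i
    rcases (by decide : ∀ i : ZMod 4, i = 0 ∨ i = 1 ∨ i = 2 ∨ i = 3) i with rfl | rfl | rfl | rfl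
    · refine ⟨?_, hdisj d02⟩
      rw [hL0, show L (0 + 2) = L 2 from rfl, hL2]
      exact Parallelograms.parallel_opposite_edges hU h𝒬 h𝒮 hvw hKU
    · refine ⟨?_, hdisj d13⟩
      rw [hL1, show L (1 + 2) = L 3 from rfl, hL3]
      exact (Parallelograms.parallel_opposite_edges' hU h𝒬 h𝒮 hvw hKU).symm
    · refine ⟨?_, hdisj (by rw [inter_comm]; exact d02)⟩
      rw [hL2, show L (2 + 2) = L 0 from rfl, hL0]
      exact (Parallelograms.parallel_opposite_edges hU h𝒬 h𝒮 hvw hKU).symm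
    · refine ⟨?_, hdisj (by rw [inter_comm]; exact d13)⟩
      rw [hL3, show L (3 + 2) = L 1 from rfl, hL1]
      exact Parallelograms.parallel_opposite_edges' hU h𝒬 h𝒮 hvw hKU
  · -- (c4) adjacent edges meet in exactly one common end
    intro i
    rcases (by decide : ∀ i : ZMod 4, i = 0 ∨ i = 1 ∨ i = 2 ∨ i = 3) i with rfl | rfl | rfl | rfl
    · rw [show L (0 + 1) = L 1 from rfl]
      exact Parallelograms.inter_eq_endpoints_inter hU h𝒬 h𝒮 hne01 hiL0 hne12 hiL1 (Or.inr rfl)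
        (Or.inl rfl) (by rw [← hA10]; exact hI c01)
    · rw [show L (1 + 1) = L 2 from rfl]
      exact Parallelograms.inter_eq_endpoints_inter hU h𝒬 h𝒮 hne12 hiL1 hne23 hiL2 (Or.inr rfl)
        (Or.inr (by ring)) (by rw [← hA11]; exact hI c12)
    · rw [show L (2 + 1) = L 3 from rfl]
      exact Parallelograms.inter_eq_endpoints_inter hU h𝒬 h𝒮 hne23 hiL2 hne30 hiL3 (Or.inl rfl)
        (Or.inr rfl) (by rw [← hA01]; exact hI c23)
    · rw [show L (3 + 1) = L 0 from rfl]
      exact Parallelograms.inter_eq_endpoints_inter hU h𝒬 h𝒮 hne30 hiL3 hne01 hiL0 (Or.inl rfl)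
        (Or.inl rfl) (by rw [← hA00]; exact hI c30)
  · -- the interior of the pre-parallelogram is `P`
    rw [Parallelograms.topology_eq_of_subset hU h𝒬 h𝒮]
    have hpre : Subtype.val '' ⋃₀ {M : Set U | Parallelograms.IsLineSegment 𝒬 M ∧
        Parallelograms.endpoints 𝒬 M ⊆ ⋃ i, L i} = closure (openParallelogram z v w) := by
      apply Subset.antisymm
      · rintro _ ⟨y, ⟨M, ⟨hM, hMe⟩, hyM⟩, rfl⟩
        obtain ⟨c, d, hcd, hMcd⟩ := hM.exists_eq_segment_of_subset hU h𝒬 h𝒮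
        have hends' := Parallelograms.image_val_endpoints_eq_of_subset hU h𝒬 h𝒮 hcd hMcd
        have hcdK : ({c, d} : Set ℂ) ⊆ closure (openParallelogram z v w) := by
          rw [← hends']
          rintro _ ⟨e, he, rfl⟩
          obtain ⟨i, hi⟩ := mem_iUnion.1 (hMe he)
          exact hLK i (mem_image_of_mem _ hi)
        exact (convex_closure_openParallelogram _ _ _).segment_subset (hcdK (mem_insert _ _))
          (hcdK (mem_insert_of_mem _ rfl)) (hMcd ▸ mem_image_of_mem _ hyM)
      · intro y hy
        rw [mem_closure_openParallelogram_iff hvw] at hy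
        obtain ⟨s, t, hs, hs1, ht, ht1, rfl⟩ := hy
        have hb₁ : z + (t : ℂ) * w ∈ Subtype.val '' L 3 := by
          rw [hiL3]; exact mem_segment_of_eq_add_mul (μ := t) ht ht1 (by ring)
        have hb₂ : z + (t : ℂ) * w + v ∈ Subtype.val '' L 1 := by
          rw [hiL1]; exact mem_segment_of_eq_add_mul (μ := t) ht ht1 (by ring)
        obtain ⟨b₁, hb₁L, hb₁e⟩ := hb₁
        obtain ⟨b₂, hb₂L, hb₂e⟩ := hb₂
        have hne : (b₁ : ℂ) ≠ b₂ := by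
          rw [hb₁e, hb₂e]; intro h; apply hv; linear_combination -h
        have hsub : segment ℝ (b₁ : ℂ) b₂ ⊆ U :=
          hsegU (hLK 3 ⟨b₁, hb₁L, rfl⟩) (hLK 1 ⟨b₂, hb₂L, rfl⟩)
        have hy : z + (s : ℂ) * v + (t : ℂ) * w ∈ segment ℝ (b₁ : ℂ) b₂ := by
          rw [hb₁e, hb₂e]; exact mem_segment_of_eq_add_mul (μ := s) hs hs1 (by ring)
        refine ⟨⟨_, hsub hy⟩, ⟨Subtype.val ⁻¹' segment ℝ (b₁ : ℂ) b₂,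
          ⟨Parallelograms.isLineSegment_of_segment_subset hU h𝒬 h𝒮 hne hsub, ?_⟩, hy⟩, rfl⟩
        rw [Parallelograms.endpoints_eq_of_subset hU h𝒬 h𝒮 hne (himg hsub)]
        rintro e ⟨-, he⟩
        simp only [mem_preimage, mem_insert_iff, mem_singleton_iff] at he
        rcases he with he | he
        · exact mem_iUnion.2 ⟨3, by rwa [show e = b₁ from Subtype.ext he]⟩
        · exact mem_iUnion.2 ⟨1, by rwa [show e = b₂ from Subtype.ext he]⟩
    have hPi : ⋃₀ {M : Set U | Parallelograms.IsLineSegment 𝒬 M ∧ Parallelograms.endpoints 𝒬 M ⊆ ⋃ i, L i} =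
        Subtype.val ⁻¹' closure (openParallelogram z v w) := by
      rw [← hpre, preimage_image_eq _ Subtype.val_injective]
    rw [hPi, ← (hU.isOpenMap_subtype_val).preimage_interior_eq_interior_preimage continuous_subtype_val,
      interior_closure_openParallelogram hvw, ← hPe, preimage_image_eq _ Subtype.val_injective]

/-- **Prop 2.5 (c)**: for an open `U ⊆ ℂ` and ANY collection `𝒮(U) ⊆ 𝒬 ⊆ 𝒫(U)`, the algorithm (a)–(c) recovers
exactly the pre-compact parallelograms: `Parallelograms.parallelograms 𝒬 = {P | val '' P ∈ 𝒫(U)}`.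
[cite: MochizukiAbsTopIII2015, Proposition 2.5 (c) p.56] -/
theorem Parallelograms.parallelograms_eq_of_subset {U : Set ℂ} (hU : IsOpen U) {𝒬 : Set (Set U)}
    (h𝒬 : ∀ Q ∈ 𝒬, Subtype.val '' Q ∈ parallelogramsIn U)
    (h𝒮 : ∀ Q : Set U, Subtype.val '' Q ∈ squaresIn U → Q ∈ 𝒬) :
    Parallelograms.parallelograms 𝒬 = {P : Set U | Subtype.val '' P ∈ parallelogramsIn U} :=
  Subset.antisymm (Parallelograms.parallelograms_subset_of_subset hU h𝒬 h𝒮)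
    fun _ hP => Parallelograms.mem_parallelograms_of_image_val_mem hU h𝒬 h𝒮 hP

/-- **Prop 2.5**, first half of the named fact `TwoOrientations`: for an open `U ⊆ ℂ` (connectedness is not
needed for this half) and `𝒬 = 𝒮(U)` the pre-compact squares, the algorithm (a)–(c) recovers exactly the
pre-compact parallelograms: `Parallelograms.parallelograms 𝒮(U) = 𝒫(U)` (as subsets of `U`).
[cite: MochizukiAbsTopIII2015, Proposition 2.5 pp.55–57] -/
theorem Parallelograms.parallelograms_squaresIn_eq {U : Set ℂ} (hU : IsOpen U) :
    Parallelograms.parallelograms {Q : Set U | Subtype.val '' Q ∈ squaresIn U} =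
      {P : Set U | Subtype.val '' P ∈ parallelogramsIn U} :=
  Parallelograms.parallelograms_eq_of_subset hU (fun _ hQ => squaresIn_subset_parallelogramsIn U hQ)
    fun _ h => h

/-- **Prop 2.5 (c)** for `𝒬 = 𝒫(U)`: running the algorithm on the parallelograms themselves returns them.
[cite: MochizukiAbsTopIII2015, Proposition 2.5 (c) p.56] -/
theorem Parallelograms.parallelograms_parallelogramsIn_eq {U : Set ℂ} (hU : IsOpen U) :
    Parallelograms.parallelograms {Q : Set U | Subtype.val '' Q ∈ parallelogramsIn U} =
      {P : Set U | Subtype.val '' P ∈ parallelogramsIn U} :=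
  Parallelograms.parallelograms_eq_of_subset hU (fun _ hQ => hQ)
    fun _ h => squaresIn_subset_parallelogramsIn U h

end

end Literature.AnabelianGeometry.AbsoluteAnabelian
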